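import Mathlib
import HarnessLib
import Summits.HubbardSuperconductivity.HubbardSuperconductivity.Theorems.KLProgrammeKLRegimeSplitBundleV11

/-!
# Route `KLProgramme` — crux K3 `KLRegimeTwoPointLimit` (stmt-HubbardSuperconductivity-19937): the GEN-4 bundle
# `klPredsV12 := { klPredsV11 with engine := EngineBoundsAtV8S }` — V11 (Δ16–Δ20) with the pair-ladder step's `1 ≤ n` conjunct
# re-typed over SIGNED real slice weights with a NEGATIVE-MASS EDGE clause (defect Δ21; cell gate-hubbard-kl, seat p1 = clause author, g7)

Δ21 (p1 g6, HOME/STATUS 19:39Z / l.1142, numbers l.1153 kit j259068; CONFIRMED by k3c1-p1 l.1183: the true slice-`n` particle–particle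
weights `z_p = β⁻¹Σ_ν ĝ_n(ν,p)ĝ_n(−ν,Qm−p)` — real, but SIGN-INDEFINITE at a pair-class total momentum `Qm ≠ 0` for a cutoff in `ν² + e²` —
carry an `n`-INDEPENDENT negative-mass fraction `φ(x) ≈ 0.2` in the edge zone `x = v_F|Qm|/Λ_n ∈ [2, 32]` of the class and `φ = 0` for
`x ≤ 1.5`; the `w ≥ 0` model of (E2-v7)'s `1 ≤ n` conjunct therefore costs `O(U²·φ)` per edge scale through the model-weight transfer term
and is not certifiable inside the decaying budget at deep scales).  RULINGS: plan g10 l.1176 (gen-4 repair duty), l.1197 (text (R-w′) = EDGE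
form, profile `klEdge G n ρ := G.bhi · min 1 (klEdgeKappa·ρ/Λ_n)`), k3c1-p2 l.1233 (child 1 needs REAL weights and a bound on the NEGATIVE
mass `Σ(|w| − w) = 2Σw⁻`, not only on the net mass; `0 ≤ Σw` droppable via its fallback), plan2 digest l.1246 (the three texts converge).

THE CLAUSE (E2-v8), `1 ≤ n`, per pair-class `Qm`:
`∃ w : TorusSite 2 L → ℝ, (Σ p, |w p|) ≤ G.bhi ∧ (Σ p, (|w p| − w p)) ≤ 2·klEdge G n |Qm|_𝕋 ∧ ∃ N, (1 + diag(↑w)·𝒞_{n−1}(Qm))·N = 1 ∧`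
(entrywise bound with V7's budget VERBATIM).  READING: `klEdge G n ρ = G.bhi` unless `klEdgeKappa·ρ < Λ_n` (DEEP inside the class,
`|Qm|_𝕋 < Λ_n/64`), where the engine owes `Σ_p w_p⁻ ≤ G.bhi·(64|Qm|_𝕋/Λ_n)` — met with room by `w := z` because there `z_p ≥ 0` TERMWISE
(plan g10 l.1197 (i) / k3c1-p2: a negative summand needs `e_K(p)·e_K(Qm−p) < −ν²`, impossible on the slice support `ν² + e² > Λ_n²/4` once
`|e_K(p) − e_K(Qm−p)| ≤ Λ_n/2`, and `FrameOK` (i) (`‖∇e_K‖ ≤ 7`) gives `|e_K(p) − e_K(p−Qm)| ≤ 7√2·|Qm|_𝕋 < Λ_n/6`); in the edge zone the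
clause is implied by the first conjunct (`Σ(|w|−w) ≤ 2Σ|w| ≤ 2·G.bhi`).  So the ENGINE takes `w := z`, `N := N_z` (k3c1-p1's
`klell_localised_ladder_rightInverse`, p466393: zero transfer term; remainder = non-ladder + localisation) and owes NO sign fact about the
bubble `B_n(Qm) = Σ_p z_p`; CHILD 1 runs its signed cascade (k3c1-p2) with per-step factor `1 + 2u·Σw⁻`, the in-class scale sum of `klEdge`
being `≤ G.bhi·(6 + 4/3)` per `Qm` (`Σ_j min 1 (2ρ·4^{j+5}) ≤ 6 + 4/3` over the in-class scales `ρ·4ʲ ≤ 1`; k3c1-p2: «cost insensitive to the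
shift»).  `klEdgeKappa := 64` (plan g11's numeral, HOME/planner-g11/PairLadderStepAtV8Rw2.lean) makes `klEdge G n ρ = G.bhi · min 1 (2ρ·4^{n+5})`
since `Λ_n = 4^{−n}/32` — k3c1-p2's `negEdgeBar` profile up to the factor `2` inside the `min`.

THE BUNDLE: `PairLadderStepAtV8` (n = 0 conjunct = V7's verbatim, Δ19 token kept) → `EngineBoundsAtV8S` (= V7S with that one token; conjunct
ORDER kept) → `histV12 := BetaSplitAtS2 ∧ RenormalisedAtF ∧ EngineBoundsAtV8S` → `TwoLegStepV12` (= V11's body read at `histV12`) →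
`klPredsV12`; slot `rfl` lemmas; component bridges as in V11; BRIDGES `pairLadderStepAtV8_of_V7` / `engineBoundsAtV8S_of_V7S` (a nonnegative
model is a signed one with zero negative mass: nothing proved on V11's ENGINE slot is lost; the two-leg slot's (E3f) antecedent is read at
the new history, as at every generation) and `engineBoundsAtV8S_iff_V7S_zero` (scale `0`: the slots coincide).  Children of gen 4:
`EngineP4 | BetaSplitP | CountertermP2 | VolumeLimitP2 | TwoPointAssemblyP3` on `klPredsV12 klWindowC`; glue `KLRegimeInductionV12P4`
(`…SplitGlueV12P4`).  Definitions (+ bookkeeping) only; nothing about the model is asserted.  Honest framing: statement repair; no engine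
stub is proved here; nothing asserts superconductivity.
-/

noncomputable section

namespace Summit.HubbardSuperconductivity.HubbardSuperconductivity.Theorems.KLRegimeSplit

set_option linter.dupNamespace false -- summit = problem name (single-conjunct summit), D-0017

open Real Finset Literature.MathematicalPhysics.QuantumLattice Literature.Probability.LatticeModels
open Summit.HubbardSuperconductivity.HubbardSuperconductivity.Theorems.KLProgrammeLegKernels

/-! ## §1 The negative-mass edge profile -/

/-- **`klEdgeKappa := 64`** (plan g11's numeral) — the edge constant: «deep inside the class» means `klEdgeKappa·|Qm|_𝕋 < Λ_n`; it dominates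
`2√2·‖∇e_K‖` for admissible frames (`FrameOK` (i): `‖∇e_K‖ ≤ 7`, `14√2 < 20 < 64`), so that deep inside `|e_K(p) − e_K(p − Qm)| < Λ_n/6 < Λ_n/2`;
its size enters child 1 only through `log₄ klEdgeKappa`. -/
def klEdgeKappa : ℝ := 64

/-- **`klEdge G n ρ := G.bhi · min 1 (klEdgeKappa·ρ/Λ_n)`** (plan g10 l.1197) — the allowed negative mass of the scale-`n` slice weights
at a pair-class total momentum of torus size `ρ`: the full mass `G.bhi` in the edge zone, `∝ ρ/Λ_n` deep inside the class. -/
def klEdge (G : GeoConsts) (n : ℕ) (ρ : ℝ) : ℝ := G.bhi * min 1 (klEdgeKappa * ρ / klScale klE0 n)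

/-- `klEdgeKappa = 64 > 0`. -/
theorem klEdgeKappa_pos : 0 < klEdgeKappa := by norm_num [klEdgeKappa]

/-- `klEdge G n ρ = G.bhi · min 1 (2ρ·4^{n+5})` — twice k3c1-p2's `negEdgeBar n ρ = min 1 (ρ·4^{n+5})` inside the `min`
(`Λ_n = 4^{−n}/32`, `64·32 = 2·4⁵`). -/
theorem klEdge_eq_pow (G : GeoConsts) (n : ℕ) (ρ : ℝ) : klEdge G n ρ = G.bhi * min 1 (2 * ρ * (4 : ℝ) ^ (n + 5)) := by
  unfold klEdge klEdgeKappa klScale klE0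
  congr 2
  rw [pow_add]
  field_simp
  norm_num
  ring

/-- `0 ≤ klEdge G n ρ` for `0 ≤ G.bhi` and `0 ≤ ρ`. -/
theorem klEdge_nonneg {G : GeoConsts} (hG : 0 ≤ G.bhi) (n : ℕ) {ρ : ℝ} (hρ : 0 ≤ ρ) : 0 ≤ klEdge G n ρ := by
  unfold klEdge
  refine mul_nonneg hG (le_min zero_le_one ?_)
  exact div_nonneg (mul_nonneg klEdgeKappa_pos.le hρ) (klth_klScale_pos n).le

/-- `klEdge G n ρ ≤ G.bhi` for `0 ≤ G.bhi`. -/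
theorem klEdge_le_bhi {G : GeoConsts} (hG : 0 ≤ G.bhi) (n : ℕ) (ρ : ℝ) : klEdge G n ρ ≤ G.bhi := by
  unfold klEdge
  exact (mul_le_mul_of_nonneg_left (min_le_left _ _) hG).trans (mul_one _).le

/-- **Edge zone**: if `Λ_n ≤ klEdgeKappa·ρ` then `klEdge G n ρ = G.bhi` (the clause asks nothing beyond the total mass). -/
theorem klEdge_eq_bhi_of_le (G : GeoConsts) {n : ℕ} {ρ : ℝ} (h : klScale klE0 n ≤ klEdgeKappa * ρ) : klEdge G n ρ = G.bhi := by
  unfold klEdge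
  rw [min_eq_left ((one_le_div (klth_klScale_pos n)).mpr h), mul_one]

/-- **Deep inside the class**: if `klEdgeKappa·ρ ≤ Λ_n` then `klEdge G n ρ = G.bhi·(klEdgeKappa·ρ/Λ_n)`. -/
theorem klEdge_eq_of_le (G : GeoConsts) {n : ℕ} {ρ : ℝ} (h : klEdgeKappa * ρ ≤ klScale klE0 n) :
    klEdge G n ρ = G.bhi * (klEdgeKappa * ρ / klScale klE0 n) := by
  unfold klEdge
  rw [min_eq_right ((div_le_one (klth_klScale_pos n)).mpr h)]

/-- Monotone in `ρ` (for `0 ≤ G.bhi`). -/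
theorem klEdge_mono {G : GeoConsts} (hG : 0 ≤ G.bhi) (n : ℕ) {ρ ρ' : ℝ} (h : ρ ≤ ρ') : klEdge G n ρ ≤ klEdge G n ρ' := by
  unfold klEdge
  refine mul_le_mul_of_nonneg_left (min_le_min_left _ ?_) hG
  exact div_le_div_of_nonneg_right (mul_le_mul_of_nonneg_left h klEdgeKappa_pos.le) (klth_klScale_pos n).le

/-! ## §2 (E2-v8): the pair-ladder step over signed real slice weights -/

section Model

variable (L M : ℕ) [NeZero L] [NeZero M]

/-- **(E2-v8) one pair-ladder step per scale, SIGNED real slice weights with a negative-mass edge** — the `n = 0` conjunct is V7's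
(Δ19: `initDevBar + legDressBarQ … 0 4`); at `1 ≤ n`, for every pair-class `Qm`: real weights `w` of total variation `≤ G.bhi` whose
NEGATIVE mass `Σ(|w| − w) = 2Σw⁻` is `≤ 2·klEdge G n |Qm|_𝕋`, a right inverse `N` of `1 + diag(w)·𝒞_{n−1}(Qm)`, and
`‖𝒞_n(Qm;k,k′) − (𝒞_{n−1}(Qm)·N)(k,k′)‖ ≤ drivePBar + eremBar + thermalBar + legDressBarQ·legSliceCountT` on the ball (budget verbatim).
The engine takes `w := z` (true aggregated slice weights) and `N := N_z`. -/
def PairLadderStepAtV8 (G : GeoConsts) (P : SplitConsts) (Q : EngConsts) (β U μ : ℝ) (K : TrigPolyC4v) (n : ℕ) : Prop :=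
  (n = 0 → ∀ Qm : TorusSite 2 L, ∀ k ∈ klBall L μ K, ∀ k' ∈ klBall L μ K,
      ‖klPairAmplitude L M β U μ K 0 Qm k k' - (U : ℂ)‖ ≤ initDevBar G U + legDressBarQ G P Q U 0 4) ∧
  (1 ≤ n → ∀ Qm : TorusSite 2 L, IsPairClassAt L Qm n →
      ∃ w : TorusSite 2 L → ℝ, (∑ p, |w p| ≤ G.bhi) ∧ (∑ p, (|w p| - w p) ≤ 2 * klEdge G n (klTorusNorm L Qm)) ∧
        ∃ N : Matrix (TorusSite 2 L) (TorusSite 2 L) ℂ,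
          (1 + Matrix.diagonal (fun p => (w p : ℂ)) * klPairArray L M β U μ K (n - 1) Qm) * N = 1 ∧
          ∀ k ∈ klBall L μ K, ∀ k' ∈ klBall L μ K,
            ‖klPairAmplitude L M β U μ K n Qm k k' - (klPairArray L M β U μ K (n - 1) Qm * N) k k'‖ ≤
              drivePBar G P U (n - 1) + eremBar G P Q U β L (n - 1) + thermalBar G P U β n +
                legDressBarQ G P Q U n (legSliceCountT L β μ K n ![k', Qm - k', Qm - k, k]))

/-- **`EngineBoundsAtV8S … G P Q K n`** = `EngineBoundsAtV7S` with (E2-v7) ↦ (E2-v8), conjunct order kept: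
(E0) ∧ (E1-v4) ∧ (E2-v8) ∧ (E2″-v6) ∧ (E2′-S3) ∧ (E2′-S2 UV) ∧ (E4) ∧ (E5-S).  Same slot type as `Preds.engine`. -/
def EngineBoundsAtV8S (G : GeoConsts) (P : SplitConsts) (Q : EngConsts) (β U μ : ℝ) (K : TrigPolyC4v) (n : ℕ) : Prop :=
  SelfEnergySymmetric L M β U μ K n ∧ KernelNormsV4 L M P Q β U μ K n ∧
    PairLadderStepAtV8 L M G P Q β U μ K n ∧ PairValueIncrementAtV6 L M G P Q β U μ K n ∧
      QuarticValueIncrementAtS3 L M G P Q β U μ K n ∧ QuarticValueUVAtS2 L M G P Q β U μ K n ∧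
        EngineFirstMoments L M G P Q β U μ K n ∧ IsoTupleL1AtS L M G P β U μ K n

/-! ## §3 The V12 history, two-leg slot and bundle -/

/-- **The comparison-frame / comparison-volume history of the V12 bundle** at scale `j`: `BetaSplitAtS2 ∧ RenormalisedAtF ∧ EngineBoundsAtV8S`. -/
def histV12 (G : GeoConsts) (P : SplitConsts) (Q : EngConsts) (R : RenConsts) (β U μ : ℝ) : TrigPolyC4v → ℕ → Prop :=
  fun K' j => BetaSplitAtS2 L M G P Q β U μ K' j ∧ RenormalisedAtF L M β U μ K' R j ∧ EngineBoundsAtV8S L M G P Q β U μ K' j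

/-- **`TwoLegStepV12 … G P Q R K n`** := `TwoLegStepG histV12 ∧ TwoLegSizesMS ∧ TwoLegAngularG ∧ TwoLegVolumeRate (histV12 ∧ TwoLegStepG histV12 ∧
TwoLegSizesMS ∧ TwoLegAngularG)` — V11's two-leg slot ((E3a) two-tier sizes incl. (E3a-MS), (E3b), (E3c), slopes, (E3g), (E3f)) read at the V12
history.  ((E3a) tier 1, `j ≤ 2`, is isotropic INCLUDING the normal direction at no extra cost: the piece `klTwoLegPolyG … K n` is the
symmetrised interpolant of an ANGULAR function flat-extended along rays by the frame-independent free-band cutoff, so its momentum derivatives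
of order `≤ 2` are tangential derivatives `∂_θ^{≤2}ν_n` and value terms — plan2 l.1246 (B).)  Same slot type as `Preds.twoLeg`. -/
def TwoLegStepV12 (G : GeoConsts) (P : SplitConsts) (Q : EngConsts) (R : RenConsts) (β U μ : ℝ) (K : TrigPolyC4v) (n : ℕ) :
    Prop :=
  TwoLegStepG L M (histV12 L M G P Q R β U μ) G P Q R β U μ K n ∧ TwoLegSizesMS L M G Q R β U μ K n ∧
    TwoLegAngularG L M G Q R β U μ K n ∧
      TwoLegVolumeRate L M
        (fun L' M' _ _ K' j => histV12 L' M' G P Q R β U μ K' j ∧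
          TwoLegStepG L' M' (histV12 L' M' G P Q R β U μ) G P Q R β U μ K' j ∧ TwoLegSizesMS L' M' G Q R β U μ K' j ∧
            TwoLegAngularG L' M' G Q R β U μ K' j)
        Q β U μ K n

end Model

/-- **`klPredsV12 : Preds`** := `{ frameOK := FrameOK, renorm := RenormalisedAtF, split := BetaSplitAtS2, engine := EngineBoundsAtV8S,
twoLeg := TwoLegStepV12 }` (= `{ klPredsV11 with engine := EngineBoundsAtV8S, twoLeg := TwoLegStepV12 }`).  Children of gen 4:
`EngineP4 | BetaSplitP | CountertermP2 | VolumeLimitP2 (FinalTwoLegVolLimit) | TwoPointAssemblyP3 (FinalTwoLegVolLimit)` on `klPredsV12 klWindowC`. -/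
def klPredsV12 : Preds where
  frameOK := FrameOK
  renorm := fun L M _ _ β U μ K R n => RenormalisedAtF L M β U μ K R n
  split := fun L M _ _ G P Q β U μ K n => BetaSplitAtS2 L M G P Q β U μ K n
  engine := fun L M _ _ G P Q β U μ K n => EngineBoundsAtV8S L M G P Q β U μ K n
  twoLeg := fun L M _ _ G P Q R β U μ K n => TwoLegStepV12 L M G P Q R β U μ K n

/-! ## §4 Bookkeeping (`rfl`-level) -/

/-- V12's frame class IS V11's (`FrameOK`). -/
theorem klPredsV12_frameOK : klPredsV12.frameOK = klPredsV11.frameOK := rfl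

/-- V12's renormalisation slot IS V11's (`RenormalisedAtF`). -/
theorem klPredsV12_renorm : klPredsV12.renorm = klPredsV11.renorm := rfl

/-- V12's split slot IS V11's (`BetaSplitAtS2`). -/
theorem klPredsV12_split : klPredsV12.split = klPredsV11.split := rfl

/-- V12's engine slot is `EngineBoundsAtV8S`. -/
theorem klPredsV12_engine_apply (L M : ℕ) [NeZero L] [NeZero M] (G : GeoConsts) (P : SplitConsts) (Q : EngConsts) (β U μ : ℝ)
    (K : TrigPolyC4v) (n : ℕ) : klPredsV12.engine L M G P Q β U μ K n = EngineBoundsAtV8S L M G P Q β U μ K n := rfl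

/-- V12's split slot is `BetaSplitAtS2`. -/
theorem klPredsV12_split_apply (L M : ℕ) [NeZero L] [NeZero M] (G : GeoConsts) (P : SplitConsts) (Q : EngConsts) (β U μ : ℝ)
    (K : TrigPolyC4v) (n : ℕ) : klPredsV12.split L M G P Q β U μ K n = BetaSplitAtS2 L M G P Q β U μ K n := rfl

/-- V12's renormalisation slot is `RenormalisedAtF`. -/
theorem klPredsV12_renorm_apply (L M : ℕ) [NeZero L] [NeZero M] (β U μ : ℝ) (K : TrigPolyC4v) (R : RenConsts) (n : ℕ) :
    klPredsV12.renorm L M β U μ K R n = RenormalisedAtF L M β U μ K R n := rfl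

/-- V12's frame class is `FrameOK`. -/
theorem klPredsV12_frameOK_apply : klPredsV12.frameOK = FrameOK := rfl

/-- V12's two-leg slot is `TwoLegStepV12`. -/
theorem klPredsV12_twoLeg (L M : ℕ) [NeZero L] [NeZero M] (G : GeoConsts) (P : SplitConsts) (Q : EngConsts) (R : RenConsts)
    (β U μ : ℝ) (K : TrigPolyC4v) (n : ℕ) :
    klPredsV12.twoLeg L M G P Q R β U μ K n = TwoLegStepV12 L M G P Q R β U μ K n := rfl

/-- The V12 history unfolds to its three slots. -/
theorem histV12_eq (L M : ℕ) [NeZero L] [NeZero M] (G : GeoConsts) (P : SplitConsts) (Q : EngConsts) (R : RenConsts) (β U μ : ℝ)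
    (K : TrigPolyC4v) (j : ℕ) :
    histV12 L M G P Q R β U μ K j =
      (BetaSplitAtS2 L M G P Q β U μ K j ∧ RenormalisedAtF L M β U μ K R j ∧ EngineBoundsAtV8S L M G P Q β U μ K j) := rfl

section Model

variable {L M : ℕ} [NeZero L] [NeZero M] {G : GeoConsts} {P : SplitConsts} {Q : EngConsts} {R : RenConsts} {β U μ : ℝ}
  {K : TrigPolyC4v} {n : ℕ}

/-- The «G» two-leg step (at the V12 history) is the first conjunct of the V12 two-leg slot. -/
theorem twoLegStepG_of_twoLegStepV12 (h : TwoLegStepV12 L M G P Q R β U μ K n) :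
    TwoLegStepG L M (histV12 L M G P Q R β U μ) G P Q R β U μ K n := h.1

/-- (E3a-MS) is the second conjunct of the V12 two-leg slot. -/
theorem twoLegSizesMS_of_twoLegStepV12 (h : TwoLegStepV12 L M G P Q R β U μ K n) : TwoLegSizesMS L M G Q R β U μ K n := h.2.1

/-- (E3g) is the third conjunct of the V12 two-leg slot. -/
theorem twoLegAngularG_of_twoLegStepV12 (h : TwoLegStepV12 L M G P Q R β U μ K n) : TwoLegAngularG L M G Q R β U μ K n := h.2.2.1

/-- The volume-rate conjunct (E3f) of the V12 two-leg slot, with its V12 antecedent. -/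
theorem twoLegVolumeRate_of_twoLegStepV12 (h : TwoLegStepV12 L M G P Q R β U μ K n) :
    TwoLegVolumeRate L M
      (fun L' M' _ _ K' j => histV12 L' M' G P Q R β U μ K' j ∧
        TwoLegStepG L' M' (histV12 L' M' G P Q R β U μ) G P Q R β U μ K' j ∧ TwoLegSizesMS L' M' G Q R β U μ K' j ∧
          TwoLegAngularG L' M' G Q R β U μ K' j)
      Q β U μ K n := h.2.2.2

/-- k3c3-p2's packaging at V12: `TwoLegStepGM histV12` (= `TwoLegStepG histV12 ∧ TwoLegSizesMS`). -/
theorem twoLegStepGM_of_twoLegStepV12 (h : TwoLegStepV12 L M G P Q R β U μ K n) :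
    TwoLegStepGM L M (histV12 L M G P Q R β U μ) G P Q R β U μ K n := ⟨h.1, h.2.1⟩

/-- k3c3-p3's packaging at V12: `TwoLegStepGA histV12` (= `TwoLegStepG histV12 ∧ TwoLegAngularG`). -/
theorem twoLegStepGA_of_twoLegStepV12 (h : TwoLegStepV12 L M G P Q R β U μ K n) :
    TwoLegStepGA L M (histV12 L M G P Q R β U μ) G P Q R β U μ K n := ⟨h.1, h.2.2.1⟩

/-- `HistP klPredsV12` below `n` yields the V12 history: `histV12 … K j` for every `j < n`. -/
theorem histV12_of_histP (h : HistP klPredsV12 L M G P Q R β U μ K n) : ∀ j < n, histV12 L M G P Q R β U μ K j :=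
  fun j hj => ⟨(h j hj).1, (h j hj).2.1, (h j hj).2.2.1⟩

/-- `HistP klPredsV12` below `n` yields the full (E3f) antecedent of V12 at that volume. -/
theorem histRateV12_of_histP (h : HistP klPredsV12 L M G P Q R β U μ K n) :
    ∀ j < n, histV12 L M G P Q R β U μ K j ∧ TwoLegStepG L M (histV12 L M G P Q R β U μ) G P Q R β U μ K j ∧
      TwoLegSizesMS L M G Q R β U μ K j ∧ TwoLegAngularG L M G Q R β U μ K j := fun j hj =>
  ⟨⟨(h j hj).1, (h j hj).2.1, (h j hj).2.2.1⟩, (h j hj).2.2.2.1, (h j hj).2.2.2.2.1, (h j hj).2.2.2.2.2.1⟩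

/-- **V12's rate clause applies whenever the comparison volume carries the V12 history** (child 2's one-liner). -/
theorem twoLegVolumeRate_apply_of_V12 (h : TwoLegStepV12 L M G P Q R β U μ K n) (hM : Q.M0 β L ≤ M) {L' M' : ℕ} [NeZero L']
    [NeZero M'] (hL : L ≤ L') (hM' : Q.M0 β L' ≤ M') (hhist : HistP klPredsV12 L' M' G P Q R β U μ K n) (θ : ℝ) :
    |klLocalPart L M β U μ K n θ - klLocalPart L' M' β U μ K n θ| ≤ Q.CL β n / L :=
  h.2.2.2 hM L' M' hL hM' (histRateV12_of_histP hhist) θ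

/-- The engine slot of the V12 history at `j`. -/
theorem engineBoundsAtV8S_of_histV12 {j : ℕ} (h : histV12 L M G P Q R β U μ K j) : EngineBoundsAtV8S L M G P Q β U μ K j := h.2.2

/-- (E2-v8) is the third conjunct of the V12 engine slot. -/
theorem pairLadderStepAtV8_of_engineBoundsAtV8S (h : EngineBoundsAtV8S L M G P Q β U μ K n) :
    PairLadderStepAtV8 L M G P Q β U μ K n := h.2.2.1

end Model

/-! ## §5 Bridges: a nonnegative model is a signed one (V7 ⇒ V8), and scale `0` -/

section Bridge

variable (L M : ℕ) [NeZero L] [NeZero M]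

/-- **A nonnegative real model is a signed one with zero negative mass**: `PairLadderStepAtV7 ⇒ PairLadderStepAtV8` (for `0 ≤ G.bhi`;
`|w| = w`, `Σ(|w| − w) = 0 ≤ 2·klEdge`). -/
theorem pairLadderStepAtV8_of_V7 {G : GeoConsts} (hG : 0 ≤ G.bhi) {P : SplitConsts} {Q : EngConsts} {β U μ : ℝ} {K : TrigPolyC4v}
    {n : ℕ} (h : PairLadderStepAtV7 L M G P Q β U μ K n) : PairLadderStepAtV8 L M G P Q β U μ K n := by
  refine ⟨h.1, fun hn Qm hQm => ?_⟩
  obtain ⟨w, hw0, hwsum, N, hN, hb⟩ := h.2 hn Qm hQm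
  have habs : ∀ p, |w p| = w p := fun p => abs_of_nonneg (hw0 p)
  refine ⟨w, ?_, ?_, N, hN, hb⟩
  · simpa only [habs] using hwsum
  · simp only [habs, sub_self, sum_const_zero]
    have hρ : 0 ≤ klTorusNorm L Qm := KLProgrammeLegKernels.torusSupNorm_nonneg _
    have := klEdge_nonneg hG n hρ
    linarith

/-- **`EngineBoundsAtV7S … n → EngineBoundsAtV8S … n`** (for `0 ≤ G.bhi`): nothing proved on the V11 engine slot is lost. -/
theorem engineBoundsAtV8S_of_V7S {G : GeoConsts} (hG : 0 ≤ G.bhi) {P : SplitConsts} {Q : EngConsts} {β U μ : ℝ} {K : TrigPolyC4v}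
    {n : ℕ} (h : EngineBoundsAtV7S L M G P Q β U μ K n) : EngineBoundsAtV8S L M G P Q β U μ K n :=
  ⟨h.1, h.2.1, pairLadderStepAtV8_of_V7 L M hG h.2.2.1, h.2.2.2.1, h.2.2.2.2.1, h.2.2.2.2.2.1, h.2.2.2.2.2.2.1, h.2.2.2.2.2.2.2⟩

/-- **At scale `0` the pair-ladder clauses COINCIDE** (their `1 ≤ n` conjuncts are vacuous). -/
theorem pairLadderStepAtV8_iff_V7_zero (G : GeoConsts) (P : SplitConsts) (Q : EngConsts) (β U μ : ℝ) (K : TrigPolyC4v) :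
    PairLadderStepAtV8 L M G P Q β U μ K 0 ↔ PairLadderStepAtV7 L M G P Q β U μ K 0 := by
  simp only [PairLadderStepAtV8, PairLadderStepAtV7, Nat.le_zero, one_ne_zero, IsEmpty.forall_iff, and_true]

/-- **At scale `0` the engine slots COINCIDE**: `EngineBoundsAtV8S … 0 ↔ EngineBoundsAtV7S … 0` — `stub_engine_scale0`'s engine-slot
content is untouched by Δ21. -/
theorem engineBoundsAtV8S_iff_V7S_zero (G : GeoConsts) (P : SplitConsts) (Q : EngConsts) (β U μ : ℝ) (K : TrigPolyC4v) :
    EngineBoundsAtV8S L M G P Q β U μ K 0 ↔ EngineBoundsAtV7S L M G P Q β U μ K 0 := by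
  unfold EngineBoundsAtV8S EngineBoundsAtV7S
  rw [pairLadderStepAtV8_iff_V7_zero]

/-- The V10/V11 history implies the V12 history (for `0 ≤ G.bhi`). -/
theorem histV12_of_histV10 {G : GeoConsts} (hG : 0 ≤ G.bhi) {P : SplitConsts} {Q : EngConsts} {R : RenConsts} {β U μ : ℝ}
    {K : TrigPolyC4v} {j : ℕ} (h : histV10 L M G P Q R β U μ K j) : histV12 L M G P Q R β U μ K j :=
  ⟨h.1, h.2.1, engineBoundsAtV8S_of_V7S L M hG h.2.2⟩

end Bridge


end Summit.HubbardSuperconductivity.HubbardSuperconductivity.Theorems.KLRegimeSplit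

end
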